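import Summits.NavierStokesRegularity.NavierStokesRegularity.Theorems.EulerZoomLiouvillePowerGaugeEulerLiouvilleBreatherPressure
import Summits.NavierStokesRegularity.NavierStokesRegularity.Theorems.EulerZoomLiouvillePowerGaugeEulerLiouvilleSelfSimilarPastProfileEquations

/-!
# Crux `EulerZoomLiouville.PowerGaugeEulerLiouville` (stmt-NavierStokesRegularity-19832), line `logtime-breathers` (T3, weak residue):
# the pressure profile of a WEAK log-time breather — `D`-growth and the weak Poisson equation

Width seat `ns-ezl-w4` (g3; weak breather rigidity, file B2).  By breather pressure slaving (ns-ezl-w3 g2,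
`PressureSlaving.inClass_breatherPressure`) the class pressure of a weak log-time breather `u(τ,y) = e^{cτ}V(e^{−cτ}y)` may be taken EXACTLY of
breather form `p(τ, y) = (e^{cτ})² Q(e^{−cτ} y)` (`τ < 0`) with a measurable profile `Q`.  For such a pair:

* `BreatherWeak.profile_pressure_growth_of_gaugeD` — the `D`-gauge `a^{2ρ}D(a) ≤ c₀` gives `∫_{B_L}|Q|^{3/2} ≤ e^{12|c|}(e^{2|c|})^{2−2ρ}c₀ · L^{2−2ρ}` for
  `L ≥ 2` (window `(−2,−1) × B_a ⊆ Q_a(0,0)`, `a = e^{2|c|}L`, Tonelli, exact slice dilation — the pattern of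
  `BreatherRigidity.lintegral_ball_avgPressure_le` without the average);
* `BreatherWeak.profile_pressure_poisson` — the weak pressure Poisson equation `∫ Q Δθ = −∫ D²θ(V, V)` from the DISTRIBUTIONAL system (one good slice of
  `IsDistributionalNSSolutionOn.ae_forall_slice_pressure_identity`, undone by the dilation `z = e^{−cτ₀}y`; template
  `Past.profile_pressure_poisson_of_distributional`).

WHAT THIS IS NOT: not NS regularity, not the crux — data bricks for the WEAK breather-rigidity member; `--supports` stmt-19832. [folklore]
-/

noncomputable section

set_option linter.dupNamespace false

open MeasureTheory Set Filter Topology Metric Function TopologicalSpace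
open scoped ENNReal NNReal RealInnerProductSpace ContDiff Laplacian

namespace Summit.NavierStokesRegularity.NavierStokesRegularity.Theorems.PowerGaugeEulerLiouville

open Literature.Analysis Literature.Analysis.FunctionSpaces Literature.Analysis.FluidPDE

namespace BreatherWeak

variable {u : ℝ → EuclideanSpace ℝ (Fin 3) → EuclideanSpace ℝ (Fin 3)} {p : ℝ → EuclideanSpace ℝ (Fin 3) → ℝ}
  {c : ℝ} {V : EuclideanSpace ℝ (Fin 3) → EuclideanSpace ℝ (Fin 3)} {Q : EuclideanSpace ℝ (Fin 3) → ℝ}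

/-! ### `D`-growth of the pressure profile at large scales -/

/-- **THE `D`-GAUGE OF A BREATHER PRESSURE IN PROFILE VARIABLES (large scales).**  If `p` is a.e.-strongly measurable on the slab,
`p(τ, y) = (e^{cτ})² Q(e^{−cτ} y)` for all `τ < 0`, and `a^{2ρ} D(a; 0; p) ≤ c₀` for all `a > 0`, then for every `L ≥ 2`
`∫_{B_L} |Q|^{3/2} ≤ e^{12|c|} (e^{2|c|})^{2−2ρ} c₀ · L^{2−2ρ}`. [folklore] -/
theorem profile_pressure_growth_of_gaugeD {ρ : ℝ} {c₀ : ℝ≥0}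
    (hpm : AEStronglyMeasurable (uncurry p)
      (volume.restrict (Iio (0 : ℝ) ×ˢ (univ : Set (EuclideanSpace ℝ (Fin 3))))))
    (hp : ∀ τ : ℝ, τ < 0 → ∀ y, p τ y = Real.exp (c * τ) ^ 2 * Q (Real.exp (-(c * τ)) • y))
    (hD : ∀ a : ℝ, 0 < a →
      ENNReal.ofReal (a ^ (2 * ρ)) * cknD a (0 : ℝ × EuclideanSpace ℝ (Fin 3)) p ≤ (c₀ : ℝ≥0∞))
    {L : ℝ} (hL : 2 ≤ L) :
    ∫⁻ z in ball (0 : EuclideanSpace ℝ (Fin 3)) L, ‖Q z‖ₑ ^ (3 / 2 : ℝ) ≤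
      ENNReal.ofReal (Real.exp (12 * |c|) * Real.exp (2 * |c|) ^ (2 - 2 * ρ)) * (c₀ : ℝ≥0∞) *
        ENNReal.ofReal (L ^ (2 - 2 * ρ)) := by
  -- adapted from `BreatherRigidity.lintegral_ball_avgPressure_le` (…BreatherPressure, ns-ezl-w4 g2): exact slices, no average
  have hL0 : 0 < L := by linarith
  have he1 : 1 ≤ Real.exp (2 * |c|) := Real.one_le_exp (by positivity)
  set a : ℝ := Real.exp (2 * |c|) * L with ha
  have haL : L ≤ a := by rw [ha]; nlinarith
  have ha0 : 0 < a := by linarith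
  -- ### (1) the gauge: `X = ∫∫_{Q_a} |p|^{3/2} ≤ a^{2−2ρ} c₀`
  set X : ℝ≥0∞ := ∫⁻ q in parabolicCylinder a (0 : ℝ × EuclideanSpace ℝ (Fin 3)),
    ‖p q.1 q.2‖ₑ ^ (3 / 2 : ℝ) with hX
  have hXle : X ≤ ENNReal.ofReal (a ^ (2 - 2 * ρ)) * (c₀ : ℝ≥0∞) := by
    have h1 := hD a ha0
    unfold cknD at h1
    have hB0 : ENNReal.ofReal (a ^ (2 * ρ)) ≠ 0 := by
      rw [ENNReal.ofReal_ne_zero_iff]; exact Real.rpow_pos_of_pos ha0 _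
    have hA0 : ENNReal.ofReal a ^ 2 ≠ 0 := pow_ne_zero _ (by rw [ENNReal.ofReal_ne_zero_iff]; exact ha0)
    have hAt : ENNReal.ofReal a ^ 2 ≠ ⊤ := ENNReal.pow_ne_top ENNReal.ofReal_ne_top
    have key : X = ENNReal.ofReal a ^ 2 * (ENNReal.ofReal (a ^ (2 * ρ)))⁻¹ *
        (ENNReal.ofReal (a ^ (2 * ρ)) * ((ENNReal.ofReal a ^ 2)⁻¹ * X)) := by
      rw [← mul_assoc, mul_assoc (ENNReal.ofReal a ^ 2), ENNReal.inv_mul_cancel hB0 ENNReal.ofReal_ne_top,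
        mul_one, ← mul_assoc, ENNReal.mul_inv_cancel hA0 hAt, one_mul]
    calc X = _ := key
      _ ≤ ENNReal.ofReal a ^ 2 * (ENNReal.ofReal (a ^ (2 * ρ)))⁻¹ * (c₀ : ℝ≥0∞) := by gcongr
      _ = ENNReal.ofReal (a ^ (2 - 2 * ρ)) * (c₀ : ℝ≥0∞) := by
          rw [← ENNReal.ofReal_inv_of_pos (Real.rpow_pos_of_pos ha0 _), ← ENNReal.ofReal_pow ha0.le,
            ← ENNReal.ofReal_mul (by positivity)]
          congr 2
          rw [Real.rpow_sub ha0, show a ^ (2 : ℝ) = a ^ (2 : ℕ) by exact_mod_cast Real.rpow_natCast a 2,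
            div_eq_mul_inv]
  -- ### (2) the window `(−2,−1) × B_a ⊆ Q_a(0,0)` and Tonelli for `p`
  have hWsub : Ioo (-2 : ℝ) (-1) ×ˢ ball (0 : EuclideanSpace ℝ (Fin 3)) a ⊆
      parabolicCylinder a (0 : ℝ × EuclideanSpace ℝ (Fin 3)) := by
    intro q hq
    rw [mem_prod, mem_Ioo, mem_ball] at hq
    rw [mem_parabolicCylinder, Prod.fst_zero, Prod.snd_zero, zero_sub]
    have ha2 : (2 : ℝ) ≤ a ^ 2 := by nlinarith
    exact ⟨⟨by linarith [hq.1.1], by linarith [hq.1.2]⟩, hq.2⟩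
  have hsubW : Ioo (-2 : ℝ) (-1) ×ˢ ball (0 : EuclideanSpace ℝ (Fin 3)) a ⊆ Iio (0 : ℝ) ×ˢ univ :=
    prod_mono (fun t ht => by have := ht.2; rw [mem_Iio]; linarith) (subset_univ _)
  have hpmW : AEMeasurable (fun q : ℝ × EuclideanSpace ℝ (Fin 3) => ‖p q.1 q.2‖ₑ ^ (3 / 2 : ℝ))
      (((volume : Measure ℝ).restrict (Ioo (-2 : ℝ) (-1))).prod
        ((volume : Measure (EuclideanSpace ℝ (Fin 3))).restrict (ball 0 a))) := by
    have h : AEMeasurable (fun q : ℝ × EuclideanSpace ℝ (Fin 3) => ‖uncurry p q‖ₑ ^ (3 / 2 : ℝ))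
        (volume.restrict (Ioo (-2 : ℝ) (-1) ×ˢ ball (0 : EuclideanSpace ℝ (Fin 3)) a)) :=
      ((hpm.mono_measure (Measure.restrict_mono hsubW le_rfl)).aemeasurable).enorm.pow_const (3 / 2 : ℝ)
    rw [Measure.volume_eq_prod, ← Measure.prod_restrict] at h
    exact h
  have hYeq : ∫⁻ q in Ioo (-2 : ℝ) (-1) ×ˢ ball (0 : EuclideanSpace ℝ (Fin 3)) a, ‖p q.1 q.2‖ₑ ^ (3 / 2 : ℝ) =
      ∫⁻ τ in Ioo (-2 : ℝ) (-1), ∫⁻ x in ball (0 : EuclideanSpace ℝ (Fin 3)) a, ‖p τ x‖ₑ ^ (3 / 2 : ℝ) := by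
    rw [Measure.volume_eq_prod, ← Measure.prod_restrict, lintegral_prod _ hpmW]
  have hY : ∫⁻ τ in Ioo (-2 : ℝ) (-1), ∫⁻ x in ball (0 : EuclideanSpace ℝ (Fin 3)) a, ‖p τ x‖ₑ ^ (3 / 2 : ℝ) ≤ X := by
    rw [← hYeq]; exact lintegral_mono_set hWsub
  -- ### (3) the slices: `e^{−12|c|} ∫_{B_L}|Q|^{3/2} ≤ ∫_{B_a}|p(τ)|^{3/2}` for `τ ∈ (−2,−1)`
  set J : ℝ≥0∞ := ∫⁻ z in ball (0 : EuclideanSpace ℝ (Fin 3)) L, ‖Q z‖ₑ ^ (3 / 2 : ℝ) with hJ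
  have hslice : ∀ τ ∈ Ioo (-2 : ℝ) (-1), ENNReal.ofReal (Real.exp (-(12 * |c|))) * J ≤
      ∫⁻ x in ball (0 : EuclideanSpace ℝ (Fin 3)) a, ‖p τ x‖ₑ ^ (3 / 2 : ℝ) := by
    intro τ hτ
    have hτ0 : τ < 0 := by linarith [hτ.2]
    have hcτ : |c * τ| ≤ 2 * |c| := by
      rw [abs_mul]
      have : |τ| ≤ 2 := by rw [abs_le]; constructor <;> linarith [hτ.1, hτ.2]
      nlinarith [abs_nonneg c]
    set E : ℝ := Real.exp (c * τ) with hE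
    set d : ℝ := Real.exp (-(c * τ)) with hd
    have hE0 : 0 < E := Real.exp_pos _
    have hd0 : 0 < d := Real.exp_pos _
    -- pointwise: `‖p τ x‖ₑ^{3/2} = ‖E²‖ₑ^{3/2} ‖Q(d x)‖ₑ^{3/2}`
    have hpt : ∀ x, ‖p τ x‖ₑ ^ (3 / 2 : ℝ) = ‖E ^ 2‖ₑ ^ (3 / 2 : ℝ) * ‖Q (d • x)‖ₑ ^ (3 / 2 : ℝ) := by
      intro x
      rw [hp τ hτ0 x, enorm_mul, ENNReal.mul_rpow_of_nonneg _ _ (by norm_num : (0 : ℝ) ≤ 3 / 2)]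
    have hamp : ENNReal.ofReal (Real.exp (-(6 * |c|))) ≤ ‖E ^ 2‖ₑ ^ (3 / 2 : ℝ) := by
      have h1 : Real.exp (-(4 * |c|)) ≤ E ^ 2 := by
        rw [hE, ← Real.exp_nat_mul, Real.exp_le_exp]
        push_cast
        linarith [neg_abs_le (c * τ), le_abs_self (c * τ)]
      have h2 : ENNReal.ofReal (Real.exp (-(4 * |c|))) ≤ ‖E ^ 2‖ₑ := by
        rw [Real.enorm_eq_ofReal (by positivity)]
        exact ENNReal.ofReal_le_ofReal h1
      calc ENNReal.ofReal (Real.exp (-(6 * |c|))) = ENNReal.ofReal (Real.exp (-(4 * |c|))) ^ (3 / 2 : ℝ) := by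
            rw [ENNReal.ofReal_rpow_of_pos (Real.exp_pos _), ← Real.exp_mul]
            ring_nf
        _ ≤ ‖E ^ 2‖ₑ ^ (3 / 2 : ℝ) := ENNReal.rpow_le_rpow h2 (by norm_num)
    -- the dilation `x ↦ d x`
    have hLa : L ≤ d * a := by
      have h1 : Real.exp (-(2 * |c|)) ≤ d := by
        rw [hd, Real.exp_le_exp]; linarith [le_abs_self (c * τ), neg_abs_le (c * τ), hcτ]
      have h2 : Real.exp (-(2 * |c|)) * a = L := by
        rw [ha, ← mul_assoc, ← Real.exp_add, neg_add_cancel, Real.exp_zero, one_mul]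
      rw [← h2]
      exact mul_le_mul_of_nonneg_right h1 ha0.le
    have hcoef : Real.exp (-(6 * |c|)) ≤ (d ^ 3)⁻¹ := by
      rw [hd, ← Real.exp_nat_mul, ← Real.exp_neg, Real.exp_le_exp]
      push_cast
      linarith [le_abs_self (c * τ), neg_abs_le (c * τ), hcτ]
    have hdil : ENNReal.ofReal (Real.exp (-(6 * |c|))) * J ≤
        ∫⁻ x in ball (0 : EuclideanSpace ℝ (Fin 3)) a, ‖Q (d • x)‖ₑ ^ (3 / 2 : ℝ) := by
      rw [lintegral_ball_comp_smul (fun x => ‖Q x‖ₑ ^ (3 / 2 : ℝ)) hd0 a]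
      exact mul_le_mul' (ENNReal.ofReal_le_ofReal hcoef) (lintegral_mono_set (ball_subset_ball hLa))
    have hsplit : Real.exp (-(12 * |c|)) = Real.exp (-(6 * |c|)) * Real.exp (-(6 * |c|)) := by
      rw [← Real.exp_add]; ring_nf
    calc ENNReal.ofReal (Real.exp (-(12 * |c|))) * J
        = ENNReal.ofReal (Real.exp (-(6 * |c|))) * (ENNReal.ofReal (Real.exp (-(6 * |c|))) * J) := by
          rw [hsplit, ENNReal.ofReal_mul (Real.exp_pos _).le, mul_assoc]
      _ ≤ ‖E ^ 2‖ₑ ^ (3 / 2 : ℝ) * ∫⁻ x in ball (0 : EuclideanSpace ℝ (Fin 3)) a, ‖Q (d • x)‖ₑ ^ (3 / 2 : ℝ) :=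
          mul_le_mul' hamp hdil
      _ = ∫⁻ x in ball (0 : EuclideanSpace ℝ (Fin 3)) a, ‖E ^ 2‖ₑ ^ (3 / 2 : ℝ) * ‖Q (d • x)‖ₑ ^ (3 / 2 : ℝ) := by
          rw [lintegral_const_mul' _ _ (ENNReal.rpow_ne_top_of_nonneg (by norm_num) enorm_ne_top)]
      _ = ∫⁻ x in ball (0 : EuclideanSpace ℝ (Fin 3)) a, ‖p τ x‖ₑ ^ (3 / 2 : ℝ) :=
          lintegral_congr fun x => (hpt x).symm
  -- ### (4) integrate over the window (length `1`) and assemble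
  have hvolW : volume (Ioo (-2 : ℝ) (-1)) = 1 := by
    rw [Real.volume_Ioo, show (-1 : ℝ) - -2 = 1 by ring, ENNReal.ofReal_one]
  have hJle : ENNReal.ofReal (Real.exp (-(12 * |c|))) * J ≤ X :=
    calc ENNReal.ofReal (Real.exp (-(12 * |c|))) * J
        = ∫⁻ _ in Ioo (-2 : ℝ) (-1), ENNReal.ofReal (Real.exp (-(12 * |c|))) * J := by
          rw [setLIntegral_const, hvolW, mul_one]
      _ ≤ ∫⁻ τ in Ioo (-2 : ℝ) (-1), ∫⁻ x in ball (0 : EuclideanSpace ℝ (Fin 3)) a, ‖p τ x‖ₑ ^ (3 / 2 : ℝ) :=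
          setLIntegral_mono_ae' measurableSet_Ioo (Eventually.of_forall fun τ hτ => hslice τ hτ)
      _ ≤ X := hY
  have haρ : a ^ (2 - 2 * ρ) = Real.exp (2 * |c|) ^ (2 - 2 * ρ) * L ^ (2 - 2 * ρ) := by
    rw [ha, Real.mul_rpow (Real.exp_pos _).le hL0.le]
  have hunit : ENNReal.ofReal (Real.exp (12 * |c|)) * ENNReal.ofReal (Real.exp (-(12 * |c|))) = 1 := by
    rw [← ENNReal.ofReal_mul (Real.exp_pos _).le, ← Real.exp_add, add_neg_cancel, Real.exp_zero, ENNReal.ofReal_one]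
  calc J = ENNReal.ofReal (Real.exp (12 * |c|)) * (ENNReal.ofReal (Real.exp (-(12 * |c|))) * J) := by
        rw [← mul_assoc, hunit, one_mul]
    _ ≤ ENNReal.ofReal (Real.exp (12 * |c|)) * X := by gcongr
    _ ≤ ENNReal.ofReal (Real.exp (12 * |c|)) * (ENNReal.ofReal (a ^ (2 - 2 * ρ)) * (c₀ : ℝ≥0∞)) := by gcongr
    _ = ENNReal.ofReal (Real.exp (12 * |c|) * Real.exp (2 * |c|) ^ (2 - 2 * ρ)) * (c₀ : ℝ≥0∞) *
          ENNReal.ofReal (L ^ (2 - 2 * ρ)) := by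
        rw [haρ, ENNReal.ofReal_mul (by positivity), ENNReal.ofReal_mul (by positivity)]
        ring

/-! ### The weak pressure Poisson equation of the profile -/

/-- **The weak pressure Poisson equation of a breather profile, distributional form.**  Let `(u, p)` be a DISTRIBUTIONAL Euler/NS pair
(viscosity `ν`) on the slab `(−∞,0) × ℝ³` of exact breather form (`V` a.e.-strongly measurable) `u(τ) = e^{cτ}V(e^{−cτ}·)`,
`p(τ) = (e^{cτ})²Q(e^{−cτ}·)` (`τ < 0`), with `‖V‖² ∈ L¹_loc` and `Q ∈ L¹_loc`.  Then `∫ Q Δθ = −∫ D²θ(V, V)` for every `θ ∈ C_c^∞(ℝ³)` (one good slice of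
the distributional pressure identity, undone by the dilation `z = e^{−cτ₀}y`). [folklore] -/
theorem profile_pressure_poisson {ν : ℝ}
    (hsol : IsDistributionalNSSolutionOn (slab (EuclideanSpace ℝ (Fin 3)) (Iio 0) isOpen_Iio) ν 0 u p)
    (hVm : AEStronglyMeasurable V volume)
    (hbr : ∀ τ : ℝ, τ < 0 → ∀ y, u τ y = Real.exp (c * τ) • V (Real.exp (-(c * τ)) • y))
    (hp : ∀ τ : ℝ, τ < 0 → ∀ y, p τ y = Real.exp (c * τ) ^ 2 * Q (Real.exp (-(c * τ)) • y))
    (hV2 : LocallyIntegrable (fun y => ‖V y‖ ^ 2) volume) (hQ1 : LocallyIntegrable Q volume)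
    {θ : EuclideanSpace ℝ (Fin 3) → ℝ} (hθ : ContDiff ℝ (⊤ : ℕ∞) θ) (hθc : HasCompactSupport θ) :
    ∫ y, Q y * (Δ θ) y = -∫ y, fderiv ℝ (fderiv ℝ θ) y (V y) (V y) := by
  -- adapted from `Past.profile_pressure_poisson_of_distributional` (…SelfSimilarPastProfileEquations, ns-ezl-w1)
  -- restrict the distributional solution to the product region `(−2,−1) × ℝ³`
  set Qs : Opens (ℝ × EuclideanSpace ℝ (Fin 3)) :=
    ⟨Ioo (-2 : ℝ) (-1) ×ˢ ((⊤ : Opens (EuclideanSpace ℝ (Fin 3))) : Set (EuclideanSpace ℝ (Fin 3))),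
      isOpen_Ioo.prod (⊤ : Opens (EuclideanSpace ℝ (Fin 3))).isOpen⟩ with hQs
  have hQle : Qs ≤ slab (EuclideanSpace ℝ (Fin 3)) (Iio 0) isOpen_Iio := by
    intro z hz
    have hz' : z ∈ Ioo (-2 : ℝ) (-1) ×ˢ ((⊤ : Opens (EuclideanSpace ℝ (Fin 3))) :
        Set (EuclideanSpace ℝ (Fin 3))) := hz
    have h12 := (mem_prod.1 hz').1.2
    exact mem_slab.2 (show z.1 < 0 by linarith)
  have hns : IsDistributionalNSSolutionOn Qs ν 0 u p := hsol.of_le hQle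
  have hslice := IsDistributionalNSSolutionOn.ae_forall_slice_pressure_identity
    (a := -2) (b := -1) (Ω := (⊤ : Opens (EuclideanSpace ℝ (Fin 3)))) hns
    (by
      have e : (uncurry (0 : ℝ → EuclideanSpace ℝ (Fin 3) → EuclideanSpace ℝ (Fin 3))) =
          fun _ => 0 := by funext z; rfl
      rw [e]; exact locallyIntegrableOn_zero) (fun φ _ => by simp)
  -- a good time
  have hne : (ae ((volume : Measure ℝ).restrict (Ioo (-2 : ℝ) (-1)))).NeBot := by
    rw [ae_neBot, Ne, Measure.restrict_eq_zero, Real.volume_Ioo]; norm_num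
  obtain ⟨τ₀, hτ₀, hτ₀I⟩ := (hslice.and (ae_restrict_mem measurableSet_Ioo)).exists
  have hτ₀0 : τ₀ < 0 := by have := hτ₀I.2; linarith
  set cc : ℝ := Real.exp (c * τ₀) with hcc
  set d : ℝ := Real.exp (-(c * τ₀)) with hd
  have hc0 : 0 < cc := Real.exp_pos _
  have hd0 : 0 < d := Real.exp_pos _
  have huτ : u τ₀ = fun x => cc • V (d • x) := by
    funext x; rw [hbr τ₀ hτ₀0 x]
  have hpτ : p τ₀ = fun x => cc ^ 2 * Q (d • x) := by
    funext x; rw [hp τ₀ hτ₀0 x]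
  -- the slice side conditions at `τ₀`
  have h1 : AEStronglyMeasurable (u τ₀)
      (volume.restrict ((⊤ : Opens (EuclideanSpace ℝ (Fin 3))) : Set (EuclideanSpace ℝ (Fin 3)))) := by
    rw [Opens.coe_top, Measure.restrict_univ, huτ]
    exact (hVm.comp_quasiMeasurePreserving (quasiMeasurePreserving_smul hd0.ne')).const_smul cc
  have h2 : LocallyIntegrableOn (fun x => ‖u τ₀ x‖ ^ 2)
      ((⊤ : Opens (EuclideanSpace ℝ (Fin 3))) : Set (EuclideanSpace ℝ (Fin 3))) volume := by
    rw [Opens.coe_top, locallyIntegrableOn_univ, huτ]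
    have h := (locallyIntegrable_comp_smul hV2 hd0.ne').smul (cc ^ 2)
    refine h.congr (Eventually.of_forall fun x => ?_)
    simp only [Pi.smul_apply, smul_eq_mul, norm_smul, Real.norm_eq_abs, abs_of_pos hc0]
    ring
  have h3 : LocallyIntegrableOn (p τ₀)
      ((⊤ : Opens (EuclideanSpace ℝ (Fin 3))) : Set (EuclideanSpace ℝ (Fin 3))) volume := by
    rw [Opens.coe_top, locallyIntegrableOn_univ, hpτ]
    have h := (locallyIntegrable_comp_smul hQ1 hd0.ne').smul (cc ^ 2)
    refine h.congr (Eventually.of_forall fun x => ?_)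
    simp only [Pi.smul_apply, smul_eq_mul]
  have key := hτ₀ h1 h2 h3
  -- the dilated test function `ψ = θ(d ·)`
  set ψ : EuclideanSpace ℝ (Fin 3) → ℝ := fun x => θ (d • x) with hψ
  have hψT : IsTestFunctionOn (⊤ : Opens (EuclideanSpace ℝ (Fin 3))) ψ :=
    ⟨hθ.comp (contDiff_const_smul d), hθc.comp_smul hd0.ne', by simp⟩
  have hid := key ψ hψT
  -- Laplacian and Hessian of the dilated test function
  have hΔψ : ∀ x, Δ ψ x = d ^ 2 * (Δ θ) (d • x) := fun x => by
    rw [hψ, laplacian_comp_smul_eq θ d x, smul_eq_mul]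
  have hHψ : ∀ x (v : EuclideanSpace ℝ (Fin 3)),
      fderiv ℝ (fderiv ℝ ψ) x v v = d ^ 2 * fderiv ℝ (fderiv ℝ θ) (d • x) v v := fun x v => by
    rw [hψ, fderiv_fderiv_comp_smul θ d]
    rfl
  -- rewrite both sides of the slice identity as dilated profile integrals
  have hvol : |((d ^ Module.finrank ℝ (EuclideanSpace ℝ (Fin 3)))⁻¹)| = (d ^ 3)⁻¹ := by
    rw [finrank_euclideanSpace_fin, abs_of_pos (by positivity)]
  have hcs1 : ∫ x, Q (d • x) * (Δ θ) (d • x) = (d ^ 3)⁻¹ * ∫ y, Q y * (Δ θ) y := by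
    have h := Measure.integral_comp_smul volume (fun y => Q y * (Δ θ) y) d
    simp only [hvol, smul_eq_mul] at h
    exact h
  have hcs2 : ∫ x, fderiv ℝ (fderiv ℝ θ) (d • x) (V (d • x)) (V (d • x)) =
      (d ^ 3)⁻¹ * ∫ y, fderiv ℝ (fderiv ℝ θ) y (V y) (V y) := by
    have h := Measure.integral_comp_smul volume (fun y => fderiv ℝ (fderiv ℝ θ) y (V y) (V y)) d
    simp only [hvol, smul_eq_mul] at h
    exact h
  have hL : ∫ x, p τ₀ x * Δ ψ x = cc ^ 2 * d ^ 2 * ((d ^ 3)⁻¹ * ∫ y, Q y * (Δ θ) y) := by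
    have e : (fun x => p τ₀ x * Δ ψ x) = fun x => (cc ^ 2 * d ^ 2) * (Q (d • x) * (Δ θ) (d • x)) := by
      funext x; rw [hpτ, hΔψ]; ring
    rw [e, integral_const_mul, hcs1]
  have hR : ∫ x, fderiv ℝ (fderiv ℝ ψ) x (u τ₀ x) (u τ₀ x) =
      cc ^ 2 * d ^ 2 * ((d ^ 3)⁻¹ * ∫ y, fderiv ℝ (fderiv ℝ θ) y (V y) (V y)) := by
    have e : (fun x => fderiv ℝ (fderiv ℝ ψ) x (u τ₀ x) (u τ₀ x)) =
        fun x => (cc ^ 2 * d ^ 2) * (fderiv ℝ (fderiv ℝ θ) (d • x) (V (d • x)) (V (d • x))) := by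
      funext x
      rw [huτ, hHψ, bilin_apply_smul_self]
      ring
    rw [e, integral_const_mul, hcs2]
  rw [hL, hR] at hid
  have hcd : cc ^ 2 * d ^ 2 * (d ^ 3)⁻¹ ≠ 0 := by positivity
  have hid' : cc ^ 2 * d ^ 2 * (d ^ 3)⁻¹ * ∫ y, Q y * (Δ θ) y =
      cc ^ 2 * d ^ 2 * (d ^ 3)⁻¹ * (-∫ y, fderiv ℝ (fderiv ℝ θ) y (V y) (V y)) := by
    linarith
  exact mul_left_cancel₀ hcd hid'

end BreatherWeak

end Summit.NavierStokesRegularity.NavierStokesRegularity.Theorems.PowerGaugeEulerLiouville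

end
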